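import Summits.MatrixMultiplication.OmegaCensus.BoxBadOddPGroupsMinimal
import Summits.MatrixMultiplication.OmegaCensus.BoxUsefulSections

/-!
# ω-census, family (b3): conjecture C9 — NO non-abelian finite `p`-group of odd order is box-useful (classification-free)

HONEST FRAMING (pub-omega census; verbatim): lottery ticket; floor = certified bounds/negative ranges.
Census BOOKKEEPING (conjecture C9 of the cell; pub-omega kernel-l4 gen 14, task K-3 file 3 of 3).  The cell's conjecture C9 (b)
(`BoxRatioSectionLaw`, STRUCTURE.md §2) predicts that a box-useful finite group is abelian, has centre of index `4` or `6`, or carries the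
`𝒞₂` package; for a `p`-group of ODD order only the first alternative is available, so C9 (b) predicts: *a box-useful `p`-group of odd
order is abelian*.  This file PROVES that prediction, unconditionally and without Rédei's classification of minimal non-abelian
`p`-groups:
* **`not_boxUseful_of_isPGroup`**: a non-abelian finite `p`-group, `p` an odd prime, is NOT box-useful.  Strong induction on `|G|`:
  either some non-trivial normal `N` has `G ⧸ N` non-abelian — then `G ⧸ N` is a smaller non-abelian `p`-group, not box-useful by
  induction, and box-usefulness would pass to the quotient (`BoxUseful.quotient`, C9 (a)) — or every proper quotient is abelian and
  `OddPGroup.not_boxUseful_of_quot_comm` (file 2: the group contains a faithful `He_p` or `M_p(m,1)`, both box-useless by stpp-1's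
  uniform planar-box families `Heis.not_boxUseful_heis`, `Mcube.not_boxUseful_mmeta`) applies;
* corollaries: `comm_of_boxUseful_of_isPGroup` (a box-useful odd `p`-group is abelian), `not_boxUseful_of_card_prime_pow` (order
  `p^n` form), and **`center_index_eq_one_of_boxUseful`** — C9 (b) HOLDS on every finite `p`-group of odd order, in the shape of
  `BoxRatioSectionLaw`'s conclusion (`boxRatioSectionLaw_of_isPGroup_odd`).
For `p = 2` the statement is false as it must be (`D₈`, `Q₈` have centre of index `4` and ARE box-useful, `boxUseful_dihedral_iff`,
`boxUseful_quaternion_iff`).  Nothing here is progress on `ω`.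
-/

namespace Summit.MatrixMultiplication.OmegaCensus

open Finset ProductBoxBound

namespace OddPGroup

universe u

/-- The induction: for every `n`, every non-abelian `p`-group of order `n` (`p ≥ 3` prime) is not box-useful. [folklore] -/
theorem not_boxUseful_of_isPGroup_card {p : ℕ} [Fact p.Prime] (hodd : Odd p) (h3 : 3 ≤ p) (n : ℕ) :
    ∀ (G : Type u) [Group G] [Fintype G] [DecidableEq G], Fintype.card G = n → IsPGroup p G →
      (∃ a b : G, a * b ≠ b * a) → ¬ BoxUseful G := by
  induction n using Nat.strong_induction_on with
  | _ n ih =>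
    intro G _ _ _ hcard hG hna hgood
    by_cases hq : ∀ N : Subgroup G, N.Normal → N ≠ ⊥ → ∀ a b : G, a * b * a⁻¹ * b⁻¹ ∈ N
    · exact not_boxUseful_of_quot_comm hG hna hq hodd h3 hgood
    · push Not at hq
      obtain ⟨N, hN, hNbot, a, b, hab⟩ := hq
      classical
      haveI : Fintype (G ⧸ N) := Fintype.ofFinite _
      -- the quotient is a smaller non-abelian `p`-group
      have hlt : Fintype.card (G ⧸ N) < n := by
        rw [← hcard, ← Nat.card_eq_fintype_card, ← Nat.card_eq_fintype_card, Subgroup.card_eq_card_quotient_mul_card_subgroup N]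
        have h1 : 1 < Nat.card N := (Subgroup.one_lt_card_iff_ne_bot N).mpr hNbot
        have h2 : 0 < Nat.card (G ⧸ N) := Nat.card_pos
        nlinarith
      have hna' : ∃ a' b' : G ⧸ N, a' * b' ≠ b' * a' := by
        by_contra hall
        push Not at hall
        apply hab
        rw [← QuotientGroup.eq_one_iff]
        rw [QuotientGroup.mk_mul, QuotientGroup.mk_mul, QuotientGroup.mk_mul, QuotientGroup.mk_inv, QuotientGroup.mk_inv,
          hall (a : G ⧸ N) (b : G ⧸ N)]
        group
      exact ih _ hlt (G ⧸ N) rfl (hG.to_quotient N) hna' (hgood.quotient N)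

variable {G : Type u} [Group G] [Fintype G] [DecidableEq G] {p : ℕ} [hp : Fact p.Prime]

/-- An odd prime is at least `3`. [folklore] -/
theorem three_le_of_odd_prime (hodd : Odd p) : 3 ≤ p := by
  have h2 := hp.out.two_le
  obtain ⟨k, hk⟩ := hodd
  omega

/-- **MAIN.  A non-abelian finite `p`-group, `p` an odd prime, is NOT box-useful** — C9 (b) on all `p`-groups of odd order, with no
appeal to the classification of minimal non-abelian `p`-groups. [folklore] -/
theorem not_boxUseful_of_isPGroup (hodd : Odd p) (hG : IsPGroup p G) (hna : ∃ a b : G, a * b ≠ b * a) : ¬ BoxUseful G :=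
  not_boxUseful_of_isPGroup_card hodd (three_le_of_odd_prime hodd) _ G rfl hG hna

/-- **A box-useful finite `p`-group of odd order is abelian.** [folklore] -/
theorem comm_of_boxUseful_of_isPGroup (hodd : Odd p) (hG : IsPGroup p G) (h : BoxUseful G) (a b : G) : a * b = b * a := by
  by_contra hab
  exact not_boxUseful_of_isPGroup hodd hG ⟨a, b, hab⟩ h

omit hp in
/-- Order form: a non-abelian group of order `p^n`, `p` an odd prime, is not box-useful. [folklore] -/
theorem not_boxUseful_of_card_prime_pow (hpr : p.Prime) (hodd : Odd p) {n : ℕ} (hcard : Fintype.card G = p ^ n)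
    (hna : ∃ a b : G, a * b ≠ b * a) : ¬ BoxUseful G := by
  haveI : Fact p.Prime := ⟨hpr⟩
  exact not_boxUseful_of_isPGroup hodd (IsPGroup.of_card (by rw [Nat.card_eq_fintype_card, hcard])) hna

/-- **C9 (b) holds on `p`-groups of odd order**: a box-useful one has centre of index `1`. [folklore] -/
theorem center_index_eq_one_of_boxUseful (hodd : Odd p) (hG : IsPGroup p G) (h : BoxUseful G) :
    (Subgroup.center G).index = 1 := by
  rw [Subgroup.index_eq_one, eq_top_iff]
  intro z _
  rw [Subgroup.mem_center_iff]
  intro g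
  exact comm_of_boxUseful_of_isPGroup hodd hG h g z

/-- **C9 (b) in the shape of `BoxRatioSectionLaw`** for `p`-groups of odd order: the centre has index `1`, `4` or `6`, or the `𝒞₂`
package is present — here always the first. [folklore] -/
theorem boxRatioSectionLaw_of_isPGroup_odd (hodd : Odd p) (hG : IsPGroup p G) (h : BoxUseful G) :
    (Subgroup.center G).index = 1 ∨ (Subgroup.center G).index = 4 ∨ (Subgroup.center G).index = 6 ∨
      ∃ (c₁ c₂ : G) (κ₁ κ₂ ε : G → ZMod 3), DihC3Sq.Coord2 c₁ c₂ κ₁ κ₂ ε :=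
  Or.inl (center_index_eq_one_of_boxUseful hodd hG h)

end OddPGroup

end Summit.MatrixMultiplication.OmegaCensus
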